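import Literature.Topology.PlanarFoliations.FrameExtract
import Literature.Topology.PlanarFoliations.SpiralFrame
import Literature.Topology.PlanarFoliations.WalkNoSpiral
import Literature.Topology.PlanarFoliations.CompactLeaf
import HarnessLib

/-!
# Hugging by an open leaf: an essential polygon in the limit graph

Topic: Topology / PlanarFoliations, sequel to `SpiralFrame.lean` (the hugging frame of an open
leaf accumulating on separatrices), `FrameExtract.lean` (the hugged walk of a frame yields an
essential simple polygon once the base loops of its periodic parts are not null-homotopic) and
`WalkNoSpiral.lean` (`walkBase_not_null_leaf`: an open leaf crossing the incoming vertical of a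
closed walk turning to the side `s` at heights accumulating to `0` forces an essential base loop).
**If the ω- or α-limit set of an open leaf `L` lying in a compact set `C ⊆ Ω` contains a point of
the domain whose leaf is not compact, there is a simple separatrix polygon with separatrices in
the limit graph of `L` whose leaf loop is not null-homotopic** (`exists_polyCycle_of_mem_limGraph`);
an invariant of the separatrices (passing from a separatrix to those leaving its ω-saddle) holding at the given point holds at its separatrices.
This is the one-sided-holonomy half of Poincaré–Bendixson used in the terminal analysis of
Novikov's compact leaf theorem: a leaf spiralling onto a separatrix graph `Γ` makes the holonomy of
`g(Γ)` non-trivial, hence `g(Γ)` essential [CamachoLinsNeto1985, Ch. VII §2, p. 136].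

## References

* C. Camacho, A. Lins Neto, *Geometric Theory of Foliations*, Birkhäuser (1985), Ch. VII §2
  [CamachoLinsNeto1985].
-/

noncomputable section

open Set Filter Function Metric unitInterval
open _root_.Topology
open Literature.Topology.FourManifolds Literature.Topology.FourManifolds.Foliation

namespace Literature.Topology.PlanarFoliations

variable {X : Type*} [TopologicalSpace X] [T2Space X] [SecondCountableTopology X] [Nonempty X] {F : Foliation ℝ X} {ι : X → ℂ}
variable {B : Type*} [NormedAddCommGroup B] [NormedSpace ℝ B] [LocallyConnectedSpace B] {M : Type*} [TopologicalSpace M]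
  {T : Foliation B M} {g : ℂ → M}

namespace StarData

variable (D : StarData F ι T g) (hbi : IsBiOriented F) (hι : IsOpenEmbedding ι) (ho : F.IsTransverselyOriented)
  {C : Set ℂ} (hC : IsCompact C) (hCΩ : C ⊆ D.Ω) {y₀ : X} [NoncompactSpace (F.Leaf y₀)]
  (hmem : ∀ q : F.Leaf y₀, ι (Leaf.pt q) ∈ C)

omit [Nonempty X] in
/-- An open leaf is not compact. [folklore] -/
theorem not_isCompact_leaf_of_noncompactSpace : ¬ IsCompact (F.leaf y₀) := fun h ↦
  (not_compactSpace_iff.2 ‹NoncompactSpace (F.Leaf y₀)›) (compactSpace_leaf_of_isCompact h)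

include ho hCΩ hmem in
/-- **An open leaf accumulating on a line leaf hugs an essential simple polygon**: if a point of
the limit graph of the open leaf `L ⊆ C` is given, there is a simple separatrix polygon in `C`
with separatrices in the limit graph of `L` whose leaf loop is not null-homotopic.
[cite: CamachoLinsNeto1985, Ch. VII §2] -/
theorem exists_polyCycle_of_mem_limGraph {y : X} (hy : ι y ∈ limGraph hbi ι y₀) {Pinv : X → Prop} (h0 : Pinv y)
    (hstep : ∀ y₁ y₂ (_ : ι y₁ ∈ limGraph hbi ι y₀) (_ : ι y₂ ∈ limGraph hbi ι y₀)
      (_ : NoncompactSpace (F.Leaf y₁)) (_ : NoncompactSpace (F.Leaf y₂)) (w : ℂ), w ∈ D.P →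
      omegaSet hbi ι y₁ = {w} → alphaSet hbi ι y₂ = {w} → Pinv y₁ → Pinv y₂) :
    ∃ Z : D.PolyCycle hbi C, (∀ i, ι (Z.sx i) ∈ limGraph hbi ι y₀ ∧ Pinv (Z.sx i)) ∧
      ¬ (Z.leafLoop hι hC).Homotopic (Path.refl _) := by
  have Fr := D.spiralFrame hbi hι hC hCΩ hmem
  set fd₀ : FData Fr := FState.canonData Fr ⟨y, hy⟩ with hfd₀
  obtain ⟨s, hs, hcross⟩ := FData.exists_cross fd₀
  have hL : ¬ IsCompact (F.leaf y₀) := not_isCompact_leaf_of_noncompactSpace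
  refine FData.exists_polyCycle ho hs fd₀ hcross hC Subset.rfl h0 (fun y₁ hy₁ y₂ hy₂ h1 hα ↦
    hstep y₁ y₂ hy₁ hy₂ (Fr.sep _ hy₁).1 (Fr.sep _ hy₂).1 _ (Fr.vω_mem hy₁) (Fr.omegaSet_eq hy₁) hα h1) fun c p _ hper hdist ↦ ?_
  -- the cycle data of the period and the built walk
  have hsx := FData.csx_leaf_injective (s := s) (fd₀ := fd₀) (c := c) (p := p) hdist
  have hturn := FData.walkJ_turn ho hs hcross hper hC (Subset.refl C)
  have hℓ := D.continuous_toLeafSpace_walkℓ hι hC (FData.cvtx_mem s fd₀ c p) (FData.csx_mem s fd₀ c p (Subset.refl C))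
    (FData.omega_csx s fd₀ c p) (FData.alpha_csx ho hs hcross hper)
  have hperJ := D.walkJ_period hι hC (FData.cvtx_mem s fd₀ c p) (FData.csx_mem s fd₀ c p (Subset.refl C))
    (FData.omega_csx s fd₀ c p) (FData.alpha_csx ho hs hcross hper)
  -- a straight piece of the planar trace, and the no-spiral argument
  have hωc := continuous_traceLoop ho hℓ hs hturn hperJ
  obtain ⟨e, he, e', he', P, a, hP⟩ := D.exists_straightPiece hι hC (FData.cvtx_mem s fd₀ c p)
    (FData.csx_mem s fd₀ c p (Subset.refl C)) (FData.omega_csx s fd₀ c p) (FData.alpha_csx ho hs hcross hper) hsx hωc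
  refine walkBase_not_null_leaf ho hℓ hs hturn hbi hperJ he he' P hP hL fun ε hε ↦ ?_
  obtain ⟨N, hN⟩ := FData.cross_walkJ ho hs hcross hper hC (Subset.refl C) ε hε
  exact hN N le_rfl

end StarData

end Literature.Topology.PlanarFoliations
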